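import Summits.CriticalPhenomena.PercolationContinuityZ3.Theorems.PercNearOneGluingNoHeavyLowerTailSahiThreeCopy

/-!
# `NoHeavyLowerTail` (crux stmt-CriticalPhenomena-4575), Sahi programme: **HARRIS'S INEQUALITY IS BERNSTEIN-POSITIVE IN THE MINIMAL
# TENSOR MULTIDEGREE `(2,…,2)`** — the two-copy form `E₂^{coin q}(f,g) = Σ_{b ∈ {0,1,2}^d} Π q_i^{b_i}(1−q_i)^{2−b_i} · h_b(f,g)` with
# `h_b(f,g) = N²_b(fg;1) − N²_b(f;g) ≥ 0` for nonnegative monotone `f, g` (census W197 "n = 2 is a theorem", typed)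

Support file (Sahi cell, seat `prim-sahi-p1`, generation 53; `--supports stmt-CriticalPhenomena-4575`); companion of `…SahiThreeCopy`.
Pure proofs plus bookkeeping definitions (`IsArr2`, `N2`, `botPt`, `botInd`, `bern2`, `profile2`); no `sorry`, standard axioms.

* `N2 b f g = Σ_{x+y=b} f(x) g(y)` (two copies); `N2_eq_N3_botInd`: `N²_b(f;g) = N³_b(f;g;1_{⊥})` — a two-copy count is a three-copy count
  whose third copy is pinned at the bottom point; hence **two-copy Harris** `N²_b(f;g) ≤ N²_b(fg;1)` (`N2_le_N2_mul`) is the case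
  `r = 1_{⊥}` of three-copy Harris `N3_le_N3_mul` (free nonnegative spectator).
* `sahiE_two_coinWeight`: `E₂^{coin q}(f,g) = E(fg) − E(f)E(g) = Σ_{b : Fin d → Fin 3} m²_b(q)·[N²_b(fg;1) − N²_b(f;g)]` for ALL real `q, f, g`
  (two independent copies grouped by profile), and `sahiE_two_coin_nonneg_coefficientwise`: every coefficient is `≥ 0` for nonnegative
  monotone `f, g` — Harris/FKG for product measures on cubes [Harris 1960; Sahi2008 `E₂`] holds COEFFICIENTWISE in the minimal multidegree,
  the `n = 2` case of the census's conjecture nC-SAHI (CENSUS §175 / W197, README "WHY IT IS NOT HOPELESS": proved there by Harris–Kleitman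
  twice; here from the three-copy induction).
[this work; statement: CENSUS §175 W197 (prim-sahi-census gen 54)]
-/

namespace Summit.CriticalPhenomena.PercolationContinuityZ3.Theorems.SahiThreeCopy

open Finset Function Literature.Combinatorics.Sahi2008
open scoped BigOperators

noncomputable section

variable {d : ℕ}

/-! ### §1 Two-copy arrangements and the pinned third copy -/

/-- `(x,y)` is a two-copy arrangement of the profile `b`: `x_i + y_i = b_i`. [this work; CENSUS §175 W197] -/
def IsArr2 (b : Fin d → ℕ) (x y : Pt d) : Prop := ∀ i, (x i).toNat + (y i).toNat = b i

/-- `IsArr2` is decidable. [this work] -/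
instance instDecidableIsArr2 (b : Fin d → ℕ) (x y : Pt d) : Decidable (IsArr2 b x y) := by
  unfold IsArr2; infer_instance

/-- The TWO-COPY FUNCTIONAL `N²_b(f;g) = Σ_{x+y=b} f(x) g(y)`. [this work; CENSUS §175 W197] -/
def N2 (b : Fin d → ℕ) (f g : Pt d → ℝ) : ℝ := ∑ x : Pt d, ∑ y : Pt d, if IsArr2 b x y then f x * g y else 0

/-- The bottom point of the cube. [this work] -/
def botPt : Pt d := fun _ => false

/-- The indicator of the bottom point. [this work] -/
def botInd : Pt d → ℝ := fun z => if z = botPt then 1 else 0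

/-- `1_{⊥} ≥ 0`. [this work] -/
theorem botInd_nonneg (z : Pt d) : 0 ≤ botInd z := by
  unfold botInd; split_ifs <;> norm_num

/-- A triple with the third copy at `⊥` is an arrangement of `b` iff the first two copies are a two-copy arrangement of `b`. [this work] -/
theorem isArr_botPt_iff (b : Fin d → ℕ) (x y : Pt d) : IsArr b x y botPt ↔ IsArr2 b x y := by
  unfold IsArr IsArr2 botPt
  simp only [Bool.toNat_false, add_zero]

/-- **`N²_b(f;g) = N³_b(f;g;1_{⊥})`**: pinning the third copy at the bottom point. [this work] -/
theorem N2_eq_N3_botInd (b : Fin d → ℕ) (f g : Pt d → ℝ) : N2 b f g = N3 b f g botInd := by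
  unfold N2 N3
  refine sum_congr rfl fun x _ => sum_congr rfl fun y _ => ?_
  rw [Finset.sum_eq_single botPt]
  · unfold botInd
    rw [if_pos rfl, mul_one]
    exact (if_congr (isArr_botPt_iff b x y) rfl rfl).symm
  · intro z _ hz
    unfold botInd
    rw [if_neg hz, mul_zero]
    split_ifs <;> rfl
  · intro h; exact absurd (mem_univ _) h

/-- **Two-copy Harris**: `N²_b(f;g) ≤ N²_b(fg;1)` for nonnegative monotone `f, g` and every profile `b` (the case `r = 1_{⊥}` of
three-copy Harris). [this work; CENSUS §175 W197 (Harris–Kleitman proof of the same)] -/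
theorem N2_le_N2_mul (b : Fin d → ℕ) {f g : Pt d → ℝ} (hf : ∀ x, 0 ≤ f x) (hfm : Monotone f) (hg : ∀ x, 0 ≤ g x)
    (hgm : Monotone g) : N2 b f g ≤ N2 b (f * g) 1 := by
  rw [N2_eq_N3_botInd, N2_eq_N3_botInd]
  exact N3_le_N3_mul d b f g botInd hf hfm hg hgm botInd_nonneg

/-! ### §2 Two independent copies grouped by profile -/

/-- The degree-`(2,…,2)` Bernstein monomial `m²_b(q) = Π_i q_i^{b_i}(1−q_i)^{2−b_i}`. [this work] -/
def bern2 (q : Fin d → ℝ) (b : Fin d → ℕ) : ℝ := ∏ i, q i ^ b i * (1 - q i) ^ (2 - b i)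

/-- `m²_b(q) ≥ 0` for `q ∈ [0,1]^d`. [this work] -/
theorem bern2_nonneg {q : Fin d → ℝ} (hq : ∀ i, 0 ≤ q i ∧ q i ≤ 1) (b : Fin d → ℕ) : 0 ≤ bern2 q b :=
  prod_nonneg fun i _ => mul_nonneg (pow_nonneg (hq i).1 _) (pow_nonneg (sub_nonneg.2 (hq i).2) _)

/-- The two-copy profile `x + y ∈ {0,1,2}^d`. [this work] -/
def profile2 (x y : Pt d) : Fin d → Fin 3 := fun i =>
  ⟨(x i).toNat + (y i).toNat, by have h1 := Bool.toNat_le (x i); have h2 := Bool.toNat_le (y i); omega⟩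

/-- A pair is a two-copy arrangement of `b ∈ {0,1,2}^d` iff `b` is its profile. [this work] -/
theorem isArr2_coe_iff (b : Fin d → Fin 3) (x y : Pt d) : IsArr2 (fun i => ((b i : Fin 3) : ℕ)) x y ↔ profile2 x y = b := by
  constructor
  · intro h; funext i; exact Fin.ext (h i)
  · rintro rfl i; rfl

/-- `w(x)w(y) = m²_{x+y}(q)` for the coin weight. [this work] -/
theorem bern2_profile2 (q : Fin d → ℝ) (x y : Pt d) :
    bern2 q (fun i => ((profile2 x y i : Fin 3) : ℕ)) = coinWeight q x * coinWeight q y := by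
  unfold bern2 coinWeight
  rw [← prod_mul_distrib]
  refine prod_congr rfl fun i _ => ?_
  simp only [profile2]
  cases x i <;> cases y i <;>
    simp only [Bool.toNat_true, Bool.toNat_false, Nat.reduceAdd, Nat.reduceSub, if_true, Bool.false_eq_true,
      if_false, pow_zero, pow_one, mul_one, one_mul] <;> ring

/-- For a fixed pair, summing `m²_b · F` over the profiles it is an arrangement of picks out `w(x)w(y)·F`. [this work] -/
theorem sum_profile2_ite (q : Fin d → ℝ) (F : ℝ) (x y : Pt d) :
    ∑ b : Fin d → Fin 3, (if IsArr2 (fun i => ((b i : Fin 3) : ℕ)) x y then bern2 q (fun i => ((b i : Fin 3) : ℕ)) * F else 0) =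
      coinWeight q x * coinWeight q y * F := by
  simp only [isArr2_coe_iff]
  rw [Fintype.sum_ite_eq, bern2_profile2]

/-- Reordering a threefold sum (plumbing). [folklore] -/
theorem sum3_comm_last (G : Pt d → Pt d → (Fin d → Fin 3) → ℝ) :
    ∑ x : Pt d, ∑ y : Pt d, ∑ b : Fin d → Fin 3, G x y b = ∑ b : Fin d → Fin 3, ∑ x : Pt d, ∑ y : Pt d, G x y b := by
  calc (∑ x : Pt d, ∑ y : Pt d, ∑ b : Fin d → Fin 3, G x y b)
      = ∑ x : Pt d, ∑ b : Fin d → Fin 3, ∑ y : Pt d, G x y b := sum_congr rfl fun x _ => sum_comm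
    _ = ∑ b : Fin d → Fin 3, ∑ x : Pt d, ∑ y : Pt d, G x y b := sum_comm

/-- **Two independent copies, grouped by profile**: `Σ_{x,y} w(x)w(y)·u(x)v(y) = Σ_{b∈{0,1,2}^d} m²_b(q)·N²_b(u;v)`. [this work] -/
theorem sum2_coin_eq (q : Fin d → ℝ) (u v : Pt d → ℝ) :
    ∑ x, ∑ y, coinWeight q x * coinWeight q y * (u x * v y) =
      ∑ b : Fin d → Fin 3, bern2 q (fun i => ((b i : Fin 3) : ℕ)) * N2 (fun i => ((b i : Fin 3) : ℕ)) u v := by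
  have h1 : ∀ x y : Pt d, coinWeight q x * coinWeight q y * (u x * v y) =
      ∑ b : Fin d → Fin 3, (if IsArr2 (fun i => ((b i : Fin 3) : ℕ)) x y then
        bern2 q (fun i => ((b i : Fin 3) : ℕ)) * (u x * v y) else 0) :=
    fun x y => (sum_profile2_ite q (u x * v y) x y).symm
  simp only [h1]
  unfold N2
  simp only [mul_sum, mul_ite, mul_zero]
  exact sum3_comm_last _

/-- `E(u)` as a two-copy sum (one idle copy). [this work] -/
theorem ex_coin_eq_sum2 (q : Fin d → ℝ) (u : Pt d → ℝ) :
    ex (coinWeight q) u = ∑ x, ∑ y, coinWeight q x * coinWeight q y * (u x * (1 : Pt d → ℝ) y) := by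
  simp only [Pi.one_apply, mul_one]
  rw [ex]
  refine sum_congr rfl fun x _ => ?_
  calc coinWeight q x * u x = coinWeight q x * u x * (∑ y, coinWeight q y) := by rw [sum_coinWeight, mul_one]
    _ = ∑ y, coinWeight q x * coinWeight q y * u x := by
        rw [mul_sum]
        exact sum_congr rfl fun y _ => by ring

/-- `E(u)E(v)` as a two-copy sum. [this work] -/
theorem ex_mul_ex_coin_eq_sum2 (q : Fin d → ℝ) (u v : Pt d → ℝ) :
    ex (coinWeight q) u * ex (coinWeight q) v = ∑ x, ∑ y, coinWeight q x * coinWeight q y * (u x * v y) := by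
  rw [ex, ex, sum_mul_sum]
  exact sum_congr rfl fun x _ => sum_congr rfl fun y _ => by ring

/-! ### §3 The two-copy expansion of `E₂` and coefficientwise Harris -/

/-- **`E₂^{coin q}(f,g) = Σ_{b ∈ {0,1,2}^d} m²_b(q)·[N²_b(fg;1) − N²_b(f;g)]`** for ALL real `q, f, g` — the covariance
`E(fg) − E(f)E(g)` [Sahi2008 `E₂`; LiebSahi2021, (1.1)] under a coin weight in the minimal tensor-Bernstein multidegree. [this work] -/
theorem sahiE_two_coinWeight (q : Fin d → ℝ) (f g : Pt d → ℝ) :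
    sahiE (coinWeight q) 2 ![f, g] = ∑ b : Fin d → Fin 3, bern2 q (fun i => ((b i : Fin 3) : ℕ)) *
      (N2 (fun i => ((b i : Fin 3) : ℕ)) (f * g) 1 - N2 (fun i => ((b i : Fin 3) : ℕ)) f g) := by
  have T1 : ex (coinWeight q) (f * g) = ∑ b : Fin d → Fin 3,
      bern2 q (fun i => ((b i : Fin 3) : ℕ)) * N2 (fun i => ((b i : Fin 3) : ℕ)) (f * g) 1 := by
    rw [ex_coin_eq_sum2, sum2_coin_eq]
  have T2 : ex (coinWeight q) f * ex (coinWeight q) g = ∑ b : Fin d → Fin 3,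
      bern2 q (fun i => ((b i : Fin 3) : ℕ)) * N2 (fun i => ((b i : Fin 3) : ℕ)) f g := by
    rw [ex_mul_ex_coin_eq_sum2, sum2_coin_eq]
  simp only [mul_sub, sum_sub_distrib]
  rw [sahiE_two, T1, T2]

/-- **Harris coefficientwise** (CENSUS §175 W197, `n = 2` of nC-SAHI): for nonnegative monotone `f, g` every coefficient is nonnegative,
`0 ≤ N²_b(fg;1) − N²_b(f;g)`. [this work] -/
theorem harris2_coeff_nonneg (b : Fin d → ℕ) {f g : Pt d → ℝ} (hf : ∀ x, 0 ≤ f x) (hfm : Monotone f) (hg : ∀ x, 0 ≤ g x)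
    (hgm : Monotone g) : 0 ≤ N2 b (f * g) 1 - N2 b f g :=
  sub_nonneg.2 (N2_le_N2_mul b hf hfm hg hgm)

/-- Hence Harris's inequality `E(f)E(g) ≤ E(fg)` for every coin weight `q ∈ [0,1]^d`, recovered from the coefficientwise statement
(the tree already has it as `SahiPositive (coinWeight q) 2`; this is the Bernstein route). [this work] -/
theorem sahiE_two_coin_nonneg_coefficientwise {q : Fin d → ℝ} (hq : ∀ i, 0 ≤ q i ∧ q i ≤ 1) {f g : Pt d → ℝ}
    (hf : ∀ x, 0 ≤ f x) (hfm : Monotone f) (hg : ∀ x, 0 ≤ g x) (hgm : Monotone g) : 0 ≤ sahiE (coinWeight q) 2 ![f, g] := by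
  rw [sahiE_two_coinWeight]
  exact sum_nonneg fun b _ => mul_nonneg (bern2_nonneg hq _) (harris2_coeff_nonneg _ hf hfm hg hgm)

end

end Summit.CriticalPhenomena.PercolationContinuityZ3.Theorems.SahiThreeCopy
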